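import Literature.Geometry.Lorentzian.TrivialDataAdmissible
import Summits.FinalStateConjecture.FinalStateConjecture.Theorems.StarvedNecksHonestFixedRadiusSettlingTStubFarCleaningHelpers
import Summits.FinalStateConjecture.FinalStateConjecture.Theorems.StarvedNecksHonestFixedRadiusSettlingTStubBroomHelpers
import HarnessLib

/-!
# Non-vacuity of the two crux-own stubs of line `Sketch` of `HonestFixedRadiusSettlingT`
# (stmt-FinalStateConjecture-17575): the trivial fibre, kernel-checked

Line `Sketch` (lead skeleton `Cruxes/HonestFixedRadiusSettlingT/Lines/Sketch.lean`) has two stubs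
owned by this crux: the ELLIPTIC `stub_farCleaning` (through every admissible datum a tame curve of
admissible data whose members off `0` are far-clean to order `(6, 5)`,
`e.IsStronglyAsymptoticallyFlatWith (G c) M 1 2 6 5`) and the DYNAMICAL `stub_coreKick` (at the
exceptional base of such a curve, a kick leaving the rays-less exceptional set). The disprover's
paper census (`Disproof.lean` §6) records both as "consistent, not vacuous"; this support file makes
the non-vacuity KERNEL-CHECKED on the one admissible datum the tree can certify, the trivial datum
`trivialData = (ℝ³, δ, 0)` (`trivialData_mem_admissibleVacuumData`):

* `trivialAFEnd_isStronglyAsymptoticallyFlatWith_zero` — the trivial datum is far-clean on its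
  tautological end to EVERY order with EVERY rate, mass `0` (its error terms vanish identically; the
  tree had only the Christodoulou–Klainerman counts `(4, 3)`);
* `farCleaning_trivialData` — the conclusion of `stub_farCleaning` at the trivial datum (constant
  curve, `FarCleaning.farCleaning_of_farClean`): the stub's target class
  `IsStronglyAsymptoticallyFlatWith … 1 2 6 5` is inhabited by admissible data and the stub holds on
  the trivial fibre;
* `broom_trivialData` — the stronger cycle-1 shape (tame, IMMERSED, INJECTIVE admissible curve with
  far-clean members: the breathing curve, `Broom.broom_of_farClean`) at the trivial datum;
* `coreKick_hypotheses_inhabited` — the hypothesis class of `stub_coreKick` (a tame curve of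
  admissible data on an end whose members off `0` are far-clean to order `(6, 5)`) is inhabited, so the
  dynamical stub is not vacuously true; its content at such a curve is the open problem (generic tame
  weak cosmic censorship + Kerr final states, `CoreReduction.T_iff_coreKick`, `wccTame_of_rayless`).

No definitions, no named facts, no `sorry`; Theses-free.
-/

set_option linter.dupNamespace false

noncomputable section

open scoped Manifold ContDiff Topology
open Filter Set Function Literature.Geometry.Lorentzian

namespace Summit.FinalStateConjecture.FinalStateConjecture.Theorems.StarvedNecks.NonVacuity

/-- **The trivial datum is far-clean to every order with every rate, mass `0`.** In the chart of
its tautological end `trivialAFEnd` (`U = {1 < ‖y‖}`, identity chart) the flat data have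
`h_ij = δ_ij` and `k_ij = 0`, so `h - (1 + 2·0/r) δ` and `k` vanish identically
(`hCoeff_sub_schwarzschildPart_trivialAFEnd`, `kCoeff_trivialAFEnd`) and all their iterated
derivatives are `o(r^{-p})` for every `p` (`isLittleO_norm_iteratedFDeriv_of_forall_eq_zero`):
`trivialAFEnd.IsStronglyAsymptoticallyFlatWith trivialData 0 β γ nh nk` for all `β γ nh nk`.
Christodoulou–Klainerman 1993, Ch. 1, (1.0.9a)–(1.0.9b) with footnote 7 (the error terms vanish
exactly for flat data; the tree's `trivialAFEnd_isStronglyAsymptoticallyFlatCK_holds` is the case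
`(3/2, 5/2, 4, 3)`). [cite: ChristodoulouKlainerman1993, Ch. 1, (1.0.9a)–(1.0.9b)] -/
theorem trivialAFEnd_isStronglyAsymptoticallyFlatWith_zero : ∀ (β γ : ℝ) (nh nk : ℕ), trivialAFEnd.IsStronglyAsymptoticallyFlatWith trivialData 0 β γ nh nk := by
  intro β γ nh nk
  unfold AFEnd.IsStronglyAsymptoticallyFlatWith
  refine ⟨fun m _ ↦ ?_, fun m _ ↦ ?_⟩
  · refine isLittleO_norm_iteratedFDeriv_of_forall_eq_zero (fun y ↦ ?_) m _ _
    exact hCoeff_sub_schwarzschildPart_trivialAFEnd y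
  · refine isLittleO_norm_iteratedFDeriv_of_forall_eq_zero (fun y ↦ ?_) m _ _
    exact kCoeff_trivialAFEnd y

/-- **`stub_farCleaning` holds on the trivial fibre.** Through the trivial datum of the Minkowski
slice passes a tame curve of admissible data, based at it, all of whose members off `0` are far-clean
to order `(6, 5)` on the curve's end — the CONSTANT curve on the sole end `trivialAFEnd`
(`FarCleaning.farCleaning_of_farClean` fed with `trivialAFEnd_isStronglyAsymptoticallyFlatWith_zero`).
In particular the target class `IsStronglyAsymptoticallyFlatWith … M 1 2 6 5` of the elliptic stub is
inhabited by admissible data (typing check of the exponents: rate `1`/`2`, counts `6`/`5`).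
[cite: Christodoulou1999, p. A24] -/
theorem farCleaning_trivialData : ∃ (e : AFEnd Minkowski.slice) (G : EuclideanSpace ℝ (Fin 1) → InitialDataSet (𝓡 3) Minkowski.slice), InitialDataSet.IsTameDataFamily e 1 G ∧ G 0 = trivialData ∧ (∀ c, G c ∈ admissibleVacuumData Minkowski.slice) ∧ ∀ c ≠ 0, ∃ M : ℝ, e.IsStronglyAsymptoticallyFlatWith (G c) M 1 2 6 5 :=
  FarCleaning.farCleaning_of_farClean trivialData_mem_admissibleVacuumData isSoleEnd_trivialAFEnd
    (trivialAFEnd_isStronglyAsymptoticallyFlatWith_zero 1 2 6 5)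

/-- **The cycle-1 broom shape holds on the trivial fibre too**: through the trivial datum passes a
tame, IMMERSED, INJECTIVE curve of admissible data, based at it, whose members off `0` are far-clean to
order `(6, 5)` — the breathing curve of the trivial datum on a collar of `trivialAFEnd`
(`Broom.broom_of_farClean`). This is the shape of witness curve tame Christodoulou genericity asks for
(minus the dynamical property), certified at one admissible datum. [cite: Christodoulou1999, p. A24] -/
theorem broom_trivialData : ∃ (e : AFEnd Minkowski.slice) (F : EuclideanSpace ℝ (Fin 1) → InitialDataSet (𝓡 3) Minkowski.slice), InitialDataSet.IsTameDataFamily e 1 F ∧ InitialDataSet.IsImmersedAtZero 1 F ∧ F 0 = trivialData ∧ Function.Injective F ∧ (∀ c, F c ∈ admissibleVacuumData Minkowski.slice) ∧ ∀ c ≠ 0, ∃ M : ℝ, e.IsStronglyAsymptoticallyFlatWith (F c) M 1 2 6 5 :=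
  Broom.broom_of_farClean trivialData_mem_admissibleVacuumData isSoleEnd_trivialAFEnd
    (trivialAFEnd_isStronglyAsymptoticallyFlatWith_zero 1 2 6 5)

/-- **The hypothesis class of the dynamical stub `stub_coreKick` is inhabited.** There are an
admissible `3`-manifold (the Minkowski slice), an end `e` and a curve `G` satisfying the three
hypotheses of `stub_coreKick` — `InitialDataSet.IsTameDataFamily e 1 G`, every member admissible,
every member off `0` far-clean to order `(6, 5)` on `e` — namely the constant curve at the trivial
datum (`farCleaning_trivialData`). So the stub is not vacuously true: what it asserts at such a curve
with an exceptional base is the open problem (generic tame weak cosmic censorship with Kerr final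
states; `CoreReduction.T_iff_coreKick`). Whether the base here, the trivial datum, is exceptional for
the rays-less property is itself undecidable in the tree (no maximal development of any datum is
constructible; `Disproof.lean` §3, §5). [cite: Christodoulou1999, p. A24] -/
theorem coreKick_hypotheses_inhabited : ∃ (e : AFEnd Minkowski.slice) (G : EuclideanSpace ℝ (Fin 1) → InitialDataSet (𝓡 3) Minkowski.slice), InitialDataSet.IsTameDataFamily e 1 G ∧ (∀ c, G c ∈ admissibleVacuumData Minkowski.slice) ∧ ∀ c ≠ 0, ∃ M : ℝ, e.IsStronglyAsymptoticallyFlatWith (G c) M 1 2 6 5 := by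
  obtain ⟨e, G, hG, -, hmem, hclean⟩ := farCleaning_trivialData
  exact ⟨e, G, hG, hmem, hclean⟩

end Summit.FinalStateConjecture.FinalStateConjecture.Theorems.StarvedNecks.NonVacuity

end
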